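import Literature.Barriers.CriticalPhenomena.WeaklySAWGrandCanonical
import Mathlib.LinearAlgebra.Matrix.NonsingularInverse
import Mathlib.Analysis.SpecificLimits.Basic
import HarnessLib

/-!
# The continuous-time walk on the torus `ℤ^d/nℤ^d`: the Laplacian `Δ_Λ`, the Feynman–Kac
# functional `E^Λ_0[e^{-∫₀ᵀ v(X_s)ds} 𝟙_{X_T = b}]` and the resolvent identity
# `∫₀^∞ E^Λ_0[e^{-∫₀ᵀ v(X_s)ds} 𝟙_{X_T = b}] dT = (-Δ_Λ + v)⁻¹_{0b}`

Support file (everything proved; no named facts) for the finite-volume side of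
Bauerschmidt–Brydges–Slade, CMP 337 (2015), arXiv:1403.7422 (`WeaklySAWFourDimLogCorrections.lean`,
namespace `Literature.Barriers.CriticalPhenomena.CTWSAW`). §3–§4 of the source work on the discrete
torus `Λ = Λ_N = ℤ^d/Lᴺℤ^d` with "the lattice Laplacian on `Λ` given by
`Δφ_x = Σ_{e:|e|=1}(φ_{x+e} - φ_x)`" (§3.3), the covariance `C = (-Δ + m²)⁻¹` (§4.1: "Let
`C = (-Δ+m²)⁻¹`, with `Δ` the discrete Laplacian on `Λ_N`"), the eigenvalue relation
`C1 = (-Δ+m²)⁻¹1 = m⁻²1` (§4.1, used for `χ̂_N = m⁻² + m⁻⁴|Λ|⁻¹D²Z_N⁰(0,0;1,1)`), and the remark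
that with `V₀ = 0` the representation gives "the simple random walk two-point function with mass
`m²`". This file supplies those objects on the WALK side, for a general period `n ≥ 1` and a
general potential, in the jump-chain coordinates of the barrier file (skeleton `ω` on `ℤ^d` folded
by the tree's `Torus.proj`, sojourn times `sojourns T s` on the simplex `sojournSet`):

* `torusStep`, `torusStepMatrix` (`(Pf)(y) = Σ_{|e|=1} f(y+ē)`), **`torusLaplacian d n = Δ_Λ`**
  (`torusLaplacian_mulVec`: `(Δ_Λf)(y) = Σ_e (f(y+ē) - f(y))`; `torusLaplacian_mulVec_one`: `Δ1 = 0`),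
  **`schrodingerMatrix d n v = -Δ_Λ + v`** (`= D - P`, `D = diag(2d+v)`: `schrodingerMatrix_eq`),
  `schrodingerMatrix_const_mulVec_one` (`(-Δ+m²)1 = m²1`);
* the resolvent for a potential `v ≥ m > 0`: `transferMatrix = D⁻¹P` (sub-stochastic: row sums
  `≤ 2d/(2d+m) < 1`, `sum_transferMatrix_pow_le`), `resolventTerm v k = T^kD⁻¹`,
  `resolventMatrix v = Σ_k T^kD⁻¹` (entrywise, `summable_resolventTerm`), the telescoping identity
  `(-Δ_Λ+v)Σ_{k<K}T^kD⁻¹ = 1 - DT^KD⁻¹` (`schrodingerMatrix_mul_sum_resolventTerm`), hence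
  **`schrodingerMatrix_inv`: `(-Δ_Λ + v)⁻¹ = Σ_k (D⁻¹P)^kD⁻¹`** (invertibility with an entrywise
  non-negative inverse, `schrodingerMatrix_inv_nonneg`), and **`C1 = m⁻²1`**:
  `schrodingerMatrix_const_inv_mulVec_one`, `sum_schrodingerMatrix_const_inv` (`Σ_{y'}C_{y,y'} = m⁻²`);
* the Feynman–Kac functional of the rate-`2d` continuous-time walk on `Λ` with generator `Δ_Λ`
  (realised, as in §2 of the source, by folding the walk on `ℤ^d`): `potentialAction`
  (`∫₀ᵀv(X_s)ds = Σᵢ v(x̄ᵢ)σᵢ`), `fkPathIntegral`, **`torusFKExpectation d n v T Φ =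
  E^Λ_0[e^{-∫₀ᵀ v(X_s)ds} Φ(X_T)]`**;
* the computation: `lintegral_Ioi_fkPathIntegral` (time integration per skeleton,
  `∫₀^∞ e^{-2dT}∫_{Δ_k(T)}e^{-Σv(x̄ᵢ)σᵢ} = Π_{i≤k}(2d+v(x̄ᵢ))⁻¹`, by the volume-preserving
  `(T,s) ↦ σ ∈ (0,∞)^{k+1}` of `WeaklySAWSojournSimplex.lean` and a factor-dependent product Fubini
  `lintegral_pi_prod_eq_prod` / `setLIntegral_pi_Ioi_prod_eq_prod`), `sum_walks_fkWeight` (walks ↔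
  step sequences, `SRW.sum_walks_eq_sum_stepSeq`), the first-step recursion `stepSeqSum_succ` and
  `stepSeqSum_eq_mulVec` (`S_k = T^kD⁻¹φ`), and finally
  **`lintegral_Ioi_torusFKExpectation`: `∫₀^∞ E^Λ_0[e^{-∫₀ᵀv(X_s)ds}Φ(X_T)]dT = Σ_b (-Δ_Λ+v)⁻¹_{0,b}Φ(b)`**
  (`v ≥ m > 0`), with the corollaries `lintegral_Ioi_torusFKExpectation_indicator` (the free
  two-point function killed at rate `v` IS the Green function `(-Δ_Λ+v)⁻¹_{0,b}`) and
  `lintegral_Ioi_torusFKExpectation_const_one` (`∫₀^∞ E^Λ_0[e^{-m²T}]dT = m⁻²`: the `V₀ = 0`,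
  `g₀ = 0` case of `χ̂_N = 1/m²`).

These are the base case `F(τ) = e^{-Σ_x v_xτ_x}` of the supersymmetric representation of §3
(Proposition 3.1, [BIS09]) on the walk side, and the linear algebra of `C = (-Δ+m²)⁻¹` used in §4.1.
All statements are folklore (Feynman–Kac for a finite-state continuous-time Markov chain; Neumann
series) and fully proved; citations locate where the source uses them.
-/

noncomputable section

open MeasureTheory Filter Topology Set
open Literature.Probability.LatticeModels
open Literature.Probability.LatticeModels.SRW (Dir stepVec StepSeq pos endpoint toWalk
  length_toWalk getVert_toWalk sum_walks_eq_sum_stepSeq card_dir)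
open scoped ENNReal BigOperators

namespace Literature.Barriers.CriticalPhenomena

namespace CTWSAW

variable {d : ℕ}

/-! ### Step sequences: first-step decomposition of the positions -/

/-- `(a·ω)(i+1) = e_a + ω(i)`: positions of a step sequence with a prepended first step.
[folklore] -/
theorem pos_cons_succ (a : Dir d) {k : ℕ} (ω : StepSeq d k) (i : ℕ) :
    pos (Fin.cons a ω : StepSeq d (k + 1)) (i + 1) = stepVec a + pos ω i := by
  unfold pos
  rw [Fin.sum_univ_succ]
  simp only [Fin.cons_zero, Fin.cons_succ, Fin.val_zero, Nat.zero_lt_succ, if_true, Fin.val_succ,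
    add_lt_add_iff_right]

/-- `(a·ω)(0) = 0`. [folklore] -/
theorem pos_cons_zero (a : Dir d) {k : ℕ} (ω : StepSeq d k) :
    pos (Fin.cons a ω : StepSeq d (k + 1)) 0 = 0 := by simp

/-! ### Folded unit steps -/

/-- The folded unit step `ē ∈ ℤ_n^d` of a direction `e = ±eᵢ`. [folklore] -/
def torusStep (n : ℕ) (e : Dir d) : TorusSite d n := Torus.proj n (stepVec e)

/-- Folded positions after a prepended first step: `proj((a·ω)(i+1)) = ā + proj(ω(i))`. [folklore] -/
theorem torusProj_pos_cons_succ (n : ℕ) (a : Dir d) {k : ℕ} (ω : StepSeq d k) (i : ℕ) :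
    Torus.proj n (pos (Fin.cons a ω : StepSeq d (k + 1)) (i + 1)) =
      torusStep n a + Torus.proj n (pos ω i) := by
  rw [pos_cons_succ, torusStep]
  funext j; simp [Torus.proj_apply]

/-- Folded endpoint after a prepended first step: `proj((a·ω)(k+1)) = ā + proj(ω(k))`
(`Torus.proj` is additive). [folklore] -/
theorem torusProj_endpoint_cons (n : ℕ) (a : Dir d) {k : ℕ} (ω : StepSeq d k) :
    Torus.proj n (endpoint (Fin.cons a ω : StepSeq d (k + 1))) =
      torusStep n a + Torus.proj n (endpoint ω) := by
  rw [SRW.endpoint_cons, torusStep]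
  funext j; simp [Torus.proj_apply]

/-- The folded origin: `proj((a·ω)(0)) = 0`. [folklore] -/
theorem torusProj_pos_cons_zero (n : ℕ) (a : Dir d) {k : ℕ} (ω : StepSeq d k) :
    Torus.proj n (pos (Fin.cons a ω : StepSeq d (k + 1)) 0) = 0 := by
  rw [pos_cons_zero]; funext j; simp [Torus.proj_apply]

/-! ### The torus Laplacian `Δ_Λ` and the Schrödinger matrix `-Δ_Λ + v` -/

section Matrices

variable (d) (n : ℕ)

/-- The step operator of the torus, `(Pf)(y) = Σ_{|e|=1} f(y + ē)` (sum over the `2d` directions,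
with multiplicity when `n ≤ 2`), as a matrix: `P_{y,y'} = #{e : y' = y + ē}`. [folklore] -/
def torusStepMatrix : Matrix (TorusSite d n) (TorusSite d n) ℝ :=
  Matrix.of fun y y' => ∑ e : Dir d, if y' = y + torusStep n e then (1 : ℝ) else 0

/-- The lattice Laplacian of the discrete torus `Λ = ℤ^d/nℤ^d`,
`(Δ_Λ f)(y) = Σ_{e : |e| = 1} (f(y+ē) - f(y))` (the generator of the rate-`2d` continuous-time
simple random walk on `Λ`), as a matrix. [cite: BauerschmidtBrydgesSlade2015LogCorr, §3.3 ("Δ is the lattice Laplacian on Λ given by Δφ_x = Σ_{e:|e|=1}(φ_{x+e} - φ_x)")] -/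
def torusLaplacian : Matrix (TorusSite d n) (TorusSite d n) ℝ :=
  torusStepMatrix d n - Matrix.diagonal fun _ => (2 * d : ℝ)

/-- `-Δ_Λ + v` for a potential `v : Λ → ℝ` (for constant `v = m²` this is `C⁻¹ = -Δ + m²` of
§4.1). [cite: BauerschmidtBrydgesSlade2015LogCorr, §4.1 ("Let C = (-Δ+m²)⁻¹, with Δ the discrete Laplacian on Λ_N")] -/
def schrodingerMatrix (v : TorusSite d n → ℝ) : Matrix (TorusSite d n) (TorusSite d n) ℝ :=
  -torusLaplacian d n + Matrix.diagonal v

/-- The diagonal part `D = 2d + v` of `-Δ_Λ + v = D - P`. [folklore] -/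
def jumpRateMatrix (v : TorusSite d n → ℝ) : Matrix (TorusSite d n) (TorusSite d n) ℝ :=
  Matrix.diagonal fun y => 2 * d + v y

/-- The one-step transfer matrix `T = D⁻¹P`, `T_{y,y'} = #{e : y' = y + ē}/(2d + v(y))`: jump to a
uniformly chosen neighbour, survive the exponential clock of the potential. [folklore] -/
def transferMatrix (v : TorusSite d n → ℝ) : Matrix (TorusSite d n) (TorusSite d n) ℝ :=
  Matrix.of fun y y' => (2 * d + v y)⁻¹ * torusStepMatrix d n y y'

variable {d n}

/-- Entries of the step matrix. [folklore] -/
theorem torusStepMatrix_apply (y y' : TorusSite d n) :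
    torusStepMatrix d n y y' = ∑ e : Dir d, if y' = y + torusStep n e then (1 : ℝ) else 0 := rfl

/-- The step matrix has non-negative entries. [folklore] -/
theorem torusStepMatrix_nonneg (y y' : TorusSite d n) : 0 ≤ torusStepMatrix d n y y' :=
  Finset.sum_nonneg fun e _ => by split_ifs <;> norm_num

/-- `-Δ_Λ + v = D - P` with `D = diag(2d + v)`, `P` the step matrix. [folklore] -/
theorem schrodingerMatrix_eq (v : TorusSite d n → ℝ) :
    schrodingerMatrix d n v = jumpRateMatrix d n v - torusStepMatrix d n := by
  rw [schrodingerMatrix, torusLaplacian, jumpRateMatrix, neg_sub, sub_add_eq_add_sub,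
    Matrix.diagonal_add]

variable [NeZero n]

/-- `(Pf)(y) = Σ_e f(y + ē)`. [folklore] -/
theorem torusStepMatrix_mulVec (f : TorusSite d n → ℝ) (y : TorusSite d n) :
    (torusStepMatrix d n).mulVec f y = ∑ e : Dir d, f (y + torusStep n e) := by
  simp only [Matrix.mulVec, dotProduct, torusStepMatrix_apply, Finset.sum_mul]
  rw [Finset.sum_comm]
  refine Finset.sum_congr rfl fun e _ => ?_
  simp only [ite_mul, one_mul, zero_mul]
  rw [Finset.sum_ite_eq' Finset.univ (y + torusStep n e)]
  simp

/-- Row sums of the step matrix: `Σ_{y'} P_{y,y'} = 2d`. [folklore] -/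
theorem sum_torusStepMatrix (y : TorusSite d n) : ∑ y', torusStepMatrix d n y y' = 2 * d := by
  have h := torusStepMatrix_mulVec (fun _ => (1 : ℝ)) y
  simp only [Matrix.mulVec, dotProduct, mul_one, Finset.sum_const, Finset.card_univ, card_dir,
    nsmul_eq_mul, Nat.cast_mul, Nat.cast_ofNat] at h
  rw [h]

/-- **`(Δ_Λ f)(y) = Σ_{|e|=1}(f(y+ē) - f(y))`**. [cite: BauerschmidtBrydgesSlade2015LogCorr, §3.3 (definition of the lattice Laplacian on Λ)] -/
theorem torusLaplacian_mulVec (f : TorusSite d n → ℝ) (y : TorusSite d n) :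
    (torusLaplacian d n).mulVec f y = ∑ e : Dir d, (f (y + torusStep n e) - f y) := by
  rw [torusLaplacian, Matrix.sub_mulVec, Pi.sub_apply, torusStepMatrix_mulVec,
    Matrix.mulVec_diagonal, Finset.sum_sub_distrib]
  simp only [Finset.sum_const, Finset.card_univ, card_dir, nsmul_eq_mul, Nat.cast_mul,
    Nat.cast_ofNat]

/-- `Δ_Λ 1 = 0` ("`Δ1 = 0`", used in §8.3). [cite: BauerschmidtBrydgesSlade2015LogCorr, §8.3 ("Δ1 = 0")] -/
theorem torusLaplacian_mulVec_one : (torusLaplacian d n).mulVec (fun _ => (1 : ℝ)) = 0 := by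
  funext y; rw [torusLaplacian_mulVec]; simp

/-- **`(-Δ_Λ + m²) 1 = m² 1`**: the constant function is an eigenfunction, i.e. `C1 = m⁻²1` for
`C = (-Δ + m²)⁻¹`. [cite: BauerschmidtBrydgesSlade2015LogCorr, §4.1 (display C1 = (-Δ+m²)⁻¹1 = m⁻²1)] -/
theorem schrodingerMatrix_const_mulVec_one (m2 : ℝ) :
    (schrodingerMatrix d n fun _ => m2).mulVec (fun _ => (1 : ℝ)) = fun _ => m2 := by
  funext y
  rw [schrodingerMatrix, Matrix.add_mulVec, Matrix.neg_mulVec, Pi.add_apply, Pi.neg_apply,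
    torusLaplacian_mulVec_one, Matrix.mulVec_diagonal]
  simp


/-! ### The resolvent `(-Δ_Λ + v)⁻¹ = Σ_k (D⁻¹P)^k D⁻¹` for a positive potential -/

omit [NeZero n] in
/-- Entries of the transfer matrix. [folklore] -/
theorem transferMatrix_apply (v : TorusSite d n → ℝ) (y y' : TorusSite d n) :
    transferMatrix d n v y y' = (2 * d + v y)⁻¹ * torusStepMatrix d n y y' := rfl

variable {v : TorusSite d n → ℝ} {m : ℝ}

omit [NeZero n] in
/-- The transfer matrix has non-negative entries (`2d + v > 0`). [folklore] -/
theorem transferMatrix_nonneg (hv : ∀ y, 0 < 2 * d + v y) (y y' : TorusSite d n) :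
    0 ≤ transferMatrix d n v y y' :=
  mul_nonneg (inv_pos.2 (hv y)).le (torusStepMatrix_nonneg y y')

/-- Row sums of the transfer matrix: `Σ_{y'} T_{y,y'} = 2d/(2d + v(y)) ≤ 2d/(2d + m)` when
`v ≥ m > -2d`. [folklore] -/
theorem sum_transferMatrix_le (hm : 0 < 2 * d + m) (hv : ∀ y, m ≤ v y) (y : TorusSite d n) :
    ∑ y', transferMatrix d n v y y' ≤ 2 * d / (2 * d + m) := by
  simp only [transferMatrix_apply]
  rw [← Finset.mul_sum, sum_torusStepMatrix, inv_mul_eq_div]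
  exact div_le_div_of_nonneg_left (by positivity) hm (by linarith [hv y])

/-- Powers of the transfer matrix are entrywise non-negative. [folklore] -/
theorem transferMatrix_pow_nonneg (hv : ∀ y, 0 < 2 * d + v y) (k : ℕ) (y y' : TorusSite d n) :
    0 ≤ (transferMatrix d n v ^ k) y y' := by
  induction k generalizing y y' with
  | zero => rw [pow_zero, Matrix.one_apply]; split_ifs <;> norm_num
  | succ k ih =>
    rw [pow_succ, Matrix.mul_apply]
    exact Finset.sum_nonneg fun z _ => mul_nonneg (ih y z) (transferMatrix_nonneg hv z y')

/-- Row sums of `T^k` are at most `θ^k`, `θ = 2d/(2d+m)`. [folklore] -/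
theorem sum_transferMatrix_pow_le (hm : 0 < 2 * d + m) (hv : ∀ y, m ≤ v y) (k : ℕ)
    (y : TorusSite d n) :
    ∑ y', (transferMatrix d n v ^ k) y y' ≤ (2 * d / (2 * d + m)) ^ k := by
  have hv' : ∀ y, 0 < 2 * d + v y := fun y => lt_of_lt_of_le hm (by linarith [hv y])
  induction k generalizing y with
  | zero =>
    rw [pow_zero, pow_zero]
    simp [Matrix.one_apply]
  | succ k ih =>
    rw [pow_succ]
    simp only [Matrix.mul_apply]
    rw [Finset.sum_comm]
    calc ∑ z, ∑ y', (transferMatrix d n v ^ k) y z * transferMatrix d n v z y'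
        = ∑ z, (transferMatrix d n v ^ k) y z * ∑ y', transferMatrix d n v z y' := by
          simp_rw [Finset.mul_sum]
      _ ≤ ∑ z, (transferMatrix d n v ^ k) y z * (2 * d / (2 * d + m)) :=
          Finset.sum_le_sum fun z _ => mul_le_mul_of_nonneg_left (sum_transferMatrix_le hm hv z)
            (transferMatrix_pow_nonneg hv' k y z)
      _ ≤ (2 * d / (2 * d + m)) ^ k * (2 * d / (2 * d + m)) := by
          rw [← Finset.sum_mul]
          exact mul_le_mul_of_nonneg_right (ih y) (by positivity)
      _ = (2 * d / (2 * d + m)) ^ (k + 1) := by rw [pow_succ]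

/-- Entries of `T^k` are at most `θ^k`. [folklore] -/
theorem transferMatrix_pow_le (hm : 0 < 2 * d + m) (hv : ∀ y, m ≤ v y) (k : ℕ)
    (y y' : TorusSite d n) :
    (transferMatrix d n v ^ k) y y' ≤ (2 * d / (2 * d + m)) ^ k := by
  have hv' : ∀ y, 0 < 2 * d + v y := fun y => lt_of_lt_of_le hm (by linarith [hv y])
  refine le_trans ?_ (sum_transferMatrix_pow_le hm hv k y)
  exact Finset.single_le_sum (fun z _ => transferMatrix_pow_nonneg hv' k y z) (Finset.mem_univ y')

/-- The `k`-jump term `T^k D⁻¹` of the resolvent series, entrywise: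
`(T^k)_{y,y'}/(2d + v(y'))`. [folklore] -/
def resolventTerm (v : TorusSite d n → ℝ) (k : ℕ) : Matrix (TorusSite d n) (TorusSite d n) ℝ :=
  transferMatrix d n v ^ k * Matrix.diagonal fun y => (2 * d + v y)⁻¹

/-- Entries of the `k`-jump term. [folklore] -/
theorem resolventTerm_apply (v : TorusSite d n → ℝ) (k : ℕ) (y y' : TorusSite d n) :
    resolventTerm v k y y' = (transferMatrix d n v ^ k) y y' * (2 * d + v y')⁻¹ := by
  rw [resolventTerm, Matrix.mul_diagonal]

/-- The `k`-jump terms are entrywise non-negative. [folklore] -/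
theorem resolventTerm_nonneg (hv : ∀ y, 0 < 2 * d + v y) (k : ℕ) (y y' : TorusSite d n) :
    0 ≤ resolventTerm v k y y' := by
  rw [resolventTerm_apply]
  exact mul_nonneg (transferMatrix_pow_nonneg hv k y y') (inv_pos.2 (hv y')).le

/-- Geometric bound on the `k`-jump terms: `≤ θ^k/(2d+m)`. [folklore] -/
theorem resolventTerm_le (hm : 0 < 2 * d + m) (hv : ∀ y, m ≤ v y) (k : ℕ) (y y' : TorusSite d n) :
    resolventTerm v k y y' ≤ (2 * d / (2 * d + m)) ^ k * (2 * d + m)⁻¹ := by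
  rw [resolventTerm_apply]
  have h1 : (2 * d + v y')⁻¹ ≤ (2 * d + m)⁻¹ := by
    rw [inv_le_inv₀ (lt_of_lt_of_le hm (by linarith [hv y'])) hm]; linarith [hv y']
  have hv' : ∀ y, 0 < 2 * d + v y := fun y => lt_of_lt_of_le hm (by linarith [hv y])
  exact mul_le_mul (transferMatrix_pow_le hm hv k y y') h1 (inv_pos.2 (hv' y')).le (by positivity)

/-- The ratio `θ = 2d/(2d+m)` lies in `[0,1)` for `m > 0`. [folklore] -/
theorem ratio_lt_one (hm : 0 < m) : 2 * (d : ℝ) / (2 * d + m) < 1 := by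
  rw [div_lt_one (by positivity)]; linarith

/-- The resolvent series converges entrywise (geometric domination, `v ≥ m > 0`). [folklore] -/
theorem summable_resolventTerm (hm : 0 < m) (hv : ∀ y, m ≤ v y) (y y' : TorusSite d n) :
    Summable fun k => resolventTerm v k y y' := by
  have hm' : 0 < 2 * d + m := by positivity
  have hv' : ∀ y, 0 < 2 * d + v y := fun y => lt_of_lt_of_le hm' (by linarith [hv y])
  refine Summable.of_nonneg_of_le (fun k => resolventTerm_nonneg hv' k y y')
    (fun k => resolventTerm_le hm' hv k y y') ?_
  exact (summable_geometric_of_lt_one (by positivity) (ratio_lt_one hm)).mul_right _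

/-- **The resolvent** `R = Σ_{k ≥ 0} (D⁻¹P)^k D⁻¹` of `-Δ_Λ + v` (`v > 0`), entrywise: the
expected total discounted time spent at `y'` by the jump chain from `y`. [folklore] -/
def resolventMatrix (v : TorusSite d n → ℝ) : Matrix (TorusSite d n) (TorusSite d n) ℝ :=
  Matrix.of fun y y' => ∑' k, resolventTerm v k y y'

/-- Entries of the resolvent. [folklore] -/
theorem resolventMatrix_apply (v : TorusSite d n → ℝ) (y y' : TorusSite d n) :
    resolventMatrix v y y' = ∑' k, resolventTerm v k y y' := rfl

/-- The resolvent has non-negative entries. [folklore] -/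
theorem resolventMatrix_nonneg (hv : ∀ y, 0 < 2 * d + v y) (y y' : TorusSite d n) :
    0 ≤ resolventMatrix v y y' :=
  tsum_nonneg fun k => resolventTerm_nonneg hv k y y'

/-- `D T = P` (`D = diag(2d+v)` with `2d + v ≠ 0`). [folklore] -/
theorem jumpRateMatrix_mul_transferMatrix (hv : ∀ y, 0 < 2 * d + v y) :
    jumpRateMatrix d n v * transferMatrix d n v = torusStepMatrix d n := by
  ext y y'
  rw [jumpRateMatrix, Matrix.diagonal_mul, transferMatrix_apply, ← mul_assoc,
    mul_inv_cancel₀ (hv y).ne', one_mul]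

/-- `D D⁻¹ = 1`. [folklore] -/
theorem jumpRateMatrix_mul_inv (hv : ∀ y, 0 < 2 * d + v y) :
    jumpRateMatrix d n v * Matrix.diagonal (fun y => (2 * d + v y)⁻¹) = 1 := by
  rw [jumpRateMatrix, Matrix.diagonal_mul_diagonal, ← Matrix.diagonal_one]
  congr 1; funext y; exact mul_inv_cancel₀ (hv y).ne'

/-- **Telescoping**: `(-Δ_Λ + v) Σ_{k<K} T^k D⁻¹ = 1 - D T^K D⁻¹`. [folklore] -/
theorem schrodingerMatrix_mul_sum_resolventTerm (hv : ∀ y, 0 < 2 * d + v y) (K : ℕ) :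
    schrodingerMatrix d n v * ∑ k ∈ Finset.range K, resolventTerm v k =
      1 - jumpRateMatrix d n v * transferMatrix d n v ^ K *
        Matrix.diagonal fun y => (2 * d + v y)⁻¹ := by
  have h1 : schrodingerMatrix d n v = jumpRateMatrix d n v * (1 - transferMatrix d n v) := by
    rw [schrodingerMatrix_eq, mul_sub, mul_one, jumpRateMatrix_mul_transferMatrix hv]
  simp only [resolventTerm]
  rw [← Finset.sum_mul, h1, mul_assoc, ← mul_assoc (1 - transferMatrix d n v), mul_neg_geom_sum,
    sub_mul, one_mul, mul_sub, jumpRateMatrix_mul_inv hv, mul_assoc]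

/-- The partial sums of the resolvent series converge entrywise to the resolvent. [folklore] -/
theorem tendsto_sum_resolventTerm (hm : 0 < m) (hv : ∀ y, m ≤ v y) (y y' : TorusSite d n) :
    Tendsto (fun K => (∑ k ∈ Finset.range K, resolventTerm v k) y y') atTop
      (𝓝 (resolventMatrix v y y')) := by
  simp only [Matrix.sum_apply, resolventMatrix_apply]
  exact (summable_resolventTerm hm hv y y').hasSum.tendsto_sum_nat

/-- The boundary term `D T^K D⁻¹` of the telescoping tends to `0` entrywise. [folklore] -/
theorem tendsto_boundaryTerm (hm : 0 < m) (hv : ∀ y, m ≤ v y) (y y' : TorusSite d n) :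
    Tendsto (fun K => (jumpRateMatrix d n v * transferMatrix d n v ^ K *
      Matrix.diagonal (fun y => (2 * d + v y)⁻¹)) y y') atTop (𝓝 0) := by
  have hm' : 0 < 2 * d + m := by positivity
  have hv' : ∀ y, 0 < 2 * d + v y := fun y => lt_of_lt_of_le hm' (by linarith [hv y])
  have heq : ∀ K, (jumpRateMatrix d n v * transferMatrix d n v ^ K *
      Matrix.diagonal (fun y => (2 * d + v y)⁻¹)) y y' =
        (2 * d + v y) * (transferMatrix d n v ^ K) y y' * (2 * d + v y')⁻¹ := fun K => by
    rw [Matrix.mul_diagonal, jumpRateMatrix, Matrix.diagonal_mul]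
  simp_rw [heq]
  have hgeom := tendsto_pow_atTop_nhds_zero_of_lt_one (by positivity : (0:ℝ) ≤ 2 * d / (2 * d + m))
    (ratio_lt_one hm)
  have h0 : Tendsto (fun K => (transferMatrix d n v ^ K) y y') atTop (𝓝 0) :=
    squeeze_zero (fun K => transferMatrix_pow_nonneg hv' K y y')
      (fun K => transferMatrix_pow_le hm' hv K y y') hgeom
  simpa using (h0.const_mul (2 * d + v y)).mul_const (2 * d + v y')⁻¹

/-- **`(-Δ_Λ + v) R = 1`**: the resolvent series is a right inverse (`v ≥ m > 0`). [folklore] -/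
theorem schrodingerMatrix_mul_resolventMatrix (hm : 0 < m) (hv : ∀ y, m ≤ v y) :
    schrodingerMatrix d n v * resolventMatrix v = 1 := by
  have hm' : 0 < 2 * d + m := by positivity
  have hv' : ∀ y, 0 < 2 * d + v y := fun y => lt_of_lt_of_le hm' (by linarith [hv y])
  ext y y'
  -- entry `(y,y')` of `A R_K` tends both to `(A R)_{y,y'}` and to `1_{y,y'}`
  have h1 : Tendsto (fun K => (schrodingerMatrix d n v * ∑ k ∈ Finset.range K, resolventTerm v k) y y')
      atTop (𝓝 ((schrodingerMatrix d n v * resolventMatrix v) y y')) := by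
    simp only [Matrix.mul_apply]
    exact tendsto_finsetSum _ fun z _ => (tendsto_sum_resolventTerm hm hv z y').const_mul _
  have h2 : Tendsto (fun K => (schrodingerMatrix d n v * ∑ k ∈ Finset.range K, resolventTerm v k) y y')
      atTop (𝓝 ((1 : Matrix (TorusSite d n) (TorusSite d n) ℝ) y y')) := by
    simp_rw [schrodingerMatrix_mul_sum_resolventTerm hv']
    simp only [Matrix.sub_apply]
    simpa using (tendsto_const_nhds (x := (1 : Matrix (TorusSite d n) (TorusSite d n) ℝ) y y')).sub
      (tendsto_boundaryTerm hm hv y y')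
  exact tendsto_nhds_unique h1 h2

/-- **`(-Δ_Λ + v)⁻¹ = Σ_k (D⁻¹P)^k D⁻¹`** for a potential `v ≥ m > 0`: the Schrödinger matrix is
invertible and its inverse is the (entrywise non-negative) resolvent series. [folklore] -/
theorem schrodingerMatrix_inv (hm : 0 < m) (hv : ∀ y, m ≤ v y) :
    (schrodingerMatrix d n v)⁻¹ = resolventMatrix v :=
  Matrix.inv_eq_right_inv (schrodingerMatrix_mul_resolventMatrix hm hv)

/-- `R (-Δ_Λ + v) = 1` as well. [folklore] -/
theorem resolventMatrix_mul_schrodingerMatrix (hm : 0 < m) (hv : ∀ y, m ≤ v y) :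
    resolventMatrix v * schrodingerMatrix d n v = 1 :=
  mul_eq_one_comm.1 (schrodingerMatrix_mul_resolventMatrix hm hv)

/-- The inverse of `-Δ_Λ + v` (`v ≥ m > 0`) has non-negative entries. [folklore] -/
theorem schrodingerMatrix_inv_nonneg (hm : 0 < m) (hv : ∀ y, m ≤ v y) (y y' : TorusSite d n) :
    0 ≤ (schrodingerMatrix d n v)⁻¹ y y' := by
  rw [schrodingerMatrix_inv hm hv]
  have hm' : 0 < 2 * d + m := by positivity
  exact resolventMatrix_nonneg (fun y => lt_of_lt_of_le hm' (by linarith [hv y])) y y'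

/-- **`C1 = m⁻²1`**: the row sums of `C = (-Δ_Λ + m²)⁻¹` are `1/m²` (`m² > 0`).
[cite: BauerschmidtBrydgesSlade2015LogCorr, §4.1 (display C1 = (-Δ+m²)⁻¹1 = m⁻²1)] -/
theorem schrodingerMatrix_const_inv_mulVec_one {m2 : ℝ} (hm2 : 0 < m2) :
    (schrodingerMatrix d n fun _ => m2)⁻¹.mulVec (fun _ => (1 : ℝ)) = fun _ => m2⁻¹ := by
  have h := resolventMatrix_mul_schrodingerMatrix (d := d) (n := n) (v := fun _ => m2) hm2
    (fun _ => le_rfl)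
  rw [schrodingerMatrix_inv hm2 (fun _ => le_rfl)]
  have h2 := congrArg (fun M : Matrix (TorusSite d n) (TorusSite d n) ℝ => M.mulVec fun _ => (1:ℝ)) h
  simp only [← Matrix.mulVec_mulVec, schrodingerMatrix_const_mulVec_one, Matrix.one_mulVec] at h2
  have h3 : (resolventMatrix fun _ => m2).mulVec (fun _ : TorusSite d n => m2) =
      m2 • (resolventMatrix fun _ => m2).mulVec (fun _ => (1 : ℝ)) := by
    rw [← Matrix.mulVec_smul]; congr 1; funext y; simp
  rw [h3] at h2
  funext y
  have h4 := congrFun h2 y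
  simp only [Pi.smul_apply, smul_eq_mul] at h4
  field_simp
  linarith

/-- Row sums of `(-Δ_Λ + m²)⁻¹`: `Σ_{y'} C_{y,y'} = 1/m²`. [cite: BauerschmidtBrydgesSlade2015LogCorr, §4.1 (display C1 = m⁻²1)] -/
theorem sum_schrodingerMatrix_const_inv {m2 : ℝ} (hm2 : 0 < m2) (y : TorusSite d n) :
    ∑ y', (schrodingerMatrix d n fun _ => m2)⁻¹ y y' = m2⁻¹ := by
  have h := congrFun (schrodingerMatrix_const_inv_mulVec_one (d := d) (n := n) hm2) y
  simpa [Matrix.mulVec, dotProduct] using h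

end Matrices

/-! ### The Feynman–Kac functional of the torus walk -/

section FeynmanKac

variable {n : ℕ}

/-- `∫₀ᵀ v(X_s) ds = Σ_i v(x̄_i) σ_i` for the folded trajectory with skeleton `ω` and sojourn times
`sojourns T s` (`x̄_i = ω(i) mod n`). [folklore] -/
def potentialAction (n : ℕ) (v : TorusSite d n → ℝ) (T : ℝ) {x : Site d} (ω : (zdGraph d).Walk 0 x)
    (s : Fin ω.length → ℝ) : ℝ :=
  ∑ i : Fin (ω.length + 1), v (Torus.proj n (ω.getVert i)) * sojourns T s i

/-- `∫_{Δ_k(T)} e^{-∫₀ᵀ v(X_s)ds} ds` over the sojourn simplex of the skeleton `ω`. [folklore] -/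
def fkPathIntegral (n : ℕ) (v : TorusSite d n → ℝ) (T : ℝ) {x : Site d}
    (ω : (zdGraph d).Walk 0 x) : ℝ≥0∞ :=
  ∫⁻ s in sojournSet ω.length T, ENNReal.ofReal (Real.exp (-potentialAction n v T ω s))

open Classical in
/-- **The Feynman–Kac functional** `E^Λ_0[e^{-∫₀ᵀ v(X_s)ds} Φ(X_T)]` of the rate-`2d`
continuous-time simple random walk on the torus `Λ = ℤ^d/nℤ^d` (generator `Δ_Λ`), realised by
folding the walk on `ℤ^d`, in the jump-chain representation:
`e^{-2dT} Σ_k Σ_{ω : |ω| = k} Φ(ω(k) mod n) ∫_{Δ_k(T)} e^{-Σ_i v(x̄_i)σ_i} ds`. [folklore] -/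
def torusFKExpectation (d n : ℕ) (v : TorusSite d n → ℝ) (T : ℝ) (Φ : TorusSite d n → ℝ≥0∞) :
    ℝ≥0∞ :=
  ENNReal.ofReal (Real.exp (-(2 * d) * T)) *
    ∑' k : ℕ, ∑ x ∈ box d k, ∑ ω ∈ (zdGraph d).finsetWalkLength k (0 : Site d) x,
      Φ (Torus.proj n x) * fkPathIntegral n v T ω

/-- The time-integrated weight of a skeleton: `Π_{i ≤ k} (2d + v(x̄_i))⁻¹` (vertices `vert 0, …,
vert k`). [folklore] -/
def fkWeight (n : ℕ) (v : TorusSite d n → ℝ) (k : ℕ) (vert : ℕ → Site d) : ℝ :=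
  ∏ i ∈ Finset.range (k + 1), (2 * d + v (Torus.proj n (vert i)))⁻¹

/-- The skeleton weight is non-negative (`2d + v > 0`). [folklore] -/
theorem fkWeight_nonneg {v : TorusSite d n → ℝ} (hv : ∀ y, 0 < 2 * d + v y) (k : ℕ)
    (vert : ℕ → Site d) : 0 ≤ fkWeight n v k vert :=
  Finset.prod_nonneg fun _ _ => (inv_pos.2 (hv _)).le

/-- The skeleton weight only depends on the first `k+1` vertices. [folklore] -/
theorem fkWeight_congr (v : TorusSite d n → ℝ) {k : ℕ} {vert vert' : ℕ → Site d}
    (h : ∀ i ≤ k, vert i = vert' i) : fkWeight n v k vert = fkWeight n v k vert' :=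
  Finset.prod_congr rfl fun i hi => by rw [h i (Nat.lt_succ_iff.1 (Finset.mem_range.1 hi))]

/-- `∫₀^∞ e^{-ax} dx = 1/a` in `ℝ≥0∞` (`a > 0`). [folklore] -/
theorem lintegral_Ioi_exp_neg_mul {a : ℝ} (ha : 0 < a) :
    ∫⁻ x in Ioi (0 : ℝ), ENNReal.ofReal (Real.exp (-a * x)) = ENNReal.ofReal a⁻¹ := by
  rw [← ofReal_integral_eq_lintegral_ofReal (exp_neg_integrableOn_Ioi 0 ha)
    (Eventually.of_forall fun x => (Real.exp_pos _).le)]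
  congr 1
  rw [integral_exp_mul_Ioi (by linarith : -a < 0) 0, mul_zero, Real.exp_zero, neg_div_neg_eq,
    one_div]

/-- **Fubini for a product integrand over a product measure on `ℝ^m`** (factor-dependent
integrands): `∫ Π_i f_i(σ_i) d(⊗μ) = Π_i ∫ f_i dμ`. [folklore] -/
theorem lintegral_pi_prod_eq_prod (μ : Measure ℝ) [SigmaFinite μ] :
    ∀ (m : ℕ) (f : Fin m → ℝ → ℝ≥0∞), (∀ i, Measurable (f i)) →
      ∫⁻ σ, ∏ i, f i (σ i) ∂(Measure.pi fun _ : Fin m => μ) = ∏ i, ∫⁻ x, f i x ∂μ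
  | 0, f, _ => by
    simp only [Finset.univ_eq_empty, Finset.prod_empty]
    rw [lintegral_const, Measure.pi_empty_univ, one_mul]
  | m + 1, f, hf => by
    have hmp := (measurePreserving_piFinSuccAbove (fun _ : Fin (m + 1) => μ) 0).symm
    rw [← hmp.lintegral_comp_emb (MeasurableEquiv.measurableEmbedding _)]
    have hsymm : ∀ p : ℝ × (Fin m → ℝ),
        (MeasurableEquiv.piFinSuccAbove (fun _ : Fin (m + 1) => ℝ) 0).symm p = Fin.cons p.1 p.2 :=
      fun p => Fin.insertNth_zero' p.1 p.2
    simp only [hsymm, Fin.prod_univ_succ, Fin.cons_zero, Fin.cons_succ]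
    have hg : Measurable fun σ : Fin m → ℝ => ∏ i : Fin m, f i.succ (σ i) :=
      Finset.measurable_prod _ fun i _ => (hf i.succ).comp (measurable_pi_apply i)
    rw [lintegral_prod_mul (hf 0).aemeasurable hg.aemeasurable,
      lintegral_pi_prod_eq_prod μ m (fun i => f i.succ) fun i => hf i.succ]

/-- The same over the open orthant of `ℝ^m` with Lebesgue measure:
`∫_{(0,∞)^m} Π_i f_i(σ_i) dσ = Π_i ∫₀^∞ f_i`. [folklore] -/
theorem setLIntegral_pi_Ioi_prod_eq_prod {m : ℕ} (f : Fin m → ℝ → ℝ≥0∞) (hf : ∀ i, Measurable (f i)) :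
    ∫⁻ σ in Set.pi univ (fun _ => Ioi (0 : ℝ)), ∏ i : Fin m, f i (σ i) =
      ∏ i, ∫⁻ x in Ioi 0, f i x := by
  rw [volume_pi, Measure.restrict_pi_pi]
  exact lintegral_pi_prod_eq_prod _ m f hf

variable {v : TorusSite d n → ℝ}

/-- **Time integration per skeleton**:
`∫₀^∞ e^{-2dT} ∫_{Δ_k(T)} e^{-Σᵢ v(x̄ᵢ)σᵢ} ds dT = Π_{i ≤ k} (2d + v(x̄_i))⁻¹` — the Poisson factor
distributes over the sojourns (`Σσ = T`), `(T,s) ↦ σ` is volume preserving onto `(0,∞)^{k+1}`, and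
each free sojourn integrates to `∫₀^∞ e^{-(2d+v(x̄ᵢ))σ}dσ = (2d + v(x̄ᵢ))⁻¹`. [folklore] -/
theorem lintegral_Ioi_fkPathIntegral (hv : ∀ y, 0 < 2 * d + v y) {x : Site d}
    (ω : (zdGraph d).Walk 0 x) :
    ∫⁻ T in Ioi 0, ENNReal.ofReal (Real.exp (-(2 * d) * T)) * fkPathIntegral n v T ω =
      ENNReal.ofReal (fkWeight n v ω.length fun i => ω.getVert i) := by
  set a : Fin (ω.length + 1) → ℝ := fun i => 2 * d + v (Torus.proj n (ω.getVert i)) with ha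
  set H : (Fin (ω.length + 1) → ℝ) → ℝ≥0∞ :=
    fun σ => ∏ i, ENNReal.ofReal (Real.exp (-(a i) * σ i)) with hH
  have hHm : Measurable H := by
    refine Finset.measurable_prod _ fun i _ => ?_
    exact (Real.continuous_exp.comp (continuous_const.mul (continuous_apply i))).measurable.ennreal_ofReal
  have hstep : ∀ T : ℝ, ENNReal.ofReal (Real.exp (-(2 * d) * T)) * fkPathIntegral n v T ω =
      ∫⁻ s in sojournSet ω.length T, H (sojourns T s) := by
    intro T
    rw [fkPathIntegral, ← lintegral_const_mul' _ _ ENNReal.ofReal_ne_top]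
    refine setLIntegral_congr_fun (measurableSet_sojournSet _ _) fun s _ => ?_
    rw [hH]
    simp only
    rw [← ENNReal.ofReal_prod_of_nonneg (fun i _ => (Real.exp_pos _).le), ← Real.exp_sum,
      ← ENNReal.ofReal_mul (Real.exp_pos _).le, ← Real.exp_add]
    congr 2
    rw [potentialAction, ha]
    simp only [neg_mul, Finset.sum_neg_distrib, add_mul, Finset.sum_add_distrib, ← Finset.mul_sum,
      sum_sojourns]
    ring
  simp_rw [hstep]
  rw [lintegral_Ioi_lintegral_sojournSet hHm, hH]
  refine (setLIntegral_pi_Ioi_prod_eq_prod (fun i x => ENNReal.ofReal (Real.exp (-(a i) * x)))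
    fun i => (by fun_prop : Measurable fun x => ENNReal.ofReal (Real.exp (-(a i) * x)))).trans ?_
  have hapos : ∀ i, 0 < a i := fun i => hv _
  have hint : ∀ i, ∫⁻ x in Ioi (0:ℝ), (fun i x => ENNReal.ofReal (Real.exp (-(a i) * x))) i x =
      ENNReal.ofReal (a i)⁻¹ := fun i => lintegral_Ioi_exp_neg_mul (hapos i)
  simp_rw [hint]
  rw [fkWeight, ← Fin.prod_univ_eq_prod_range (fun i => (2 * d + v (Torus.proj n (ω.getVert i)))⁻¹),
    ENNReal.ofReal_prod_of_nonneg (fun i _ => (inv_pos.2 (hv _)).le)]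

/-- Measurability in `T` of the Poisson-weighted Feynman–Kac path integral. [folklore] -/
theorem measurable_fkPathIntegral_weighted (v : TorusSite d n → ℝ) {x : Site d}
    (ω : (zdGraph d).Walk 0 x) :
    Measurable fun T : ℝ => ENNReal.ofReal (Real.exp (-(2 * d) * T)) * fkPathIntegral n v T ω := by
  have hpi : Measurable fun T : ℝ => fkPathIntegral n v T ω := by
    have h := measurable_lintegral_sojournSet (n := ω.length)
      (H := fun σ => ENNReal.ofReal (Real.exp
        (-∑ i : Fin (ω.length + 1), v (Torus.proj n (ω.getVert i)) * σ i)))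
      (ENNReal.measurable_ofReal.comp (Real.measurable_exp.comp (Measurable.neg
        (Finset.measurable_sum _ fun i _ => measurable_const.mul (measurable_pi_apply i)))))
    exact h
  exact (ENNReal.measurable_ofReal.comp (Real.measurable_exp.comp
    (measurable_const.mul measurable_id))).mul hpi

/-- **Transfer to step sequences**: the `k`-jump layer of the time-integrated functional is a sum
over `k`-step sequences of `Φ(ω(k) mod n) Π_{i≤k}(2d + v(ω(i) mod n))⁻¹`. [folklore] -/
theorem sum_walks_fkWeight (v : TorusSite d n → ℝ) (Φ : TorusSite d n → ℝ≥0∞) (k : ℕ) :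
    ∑ x ∈ box d k, ∑ ω ∈ (zdGraph d).finsetWalkLength k (0 : Site d) x,
        Φ (Torus.proj n x) * ENNReal.ofReal (fkWeight n v ω.length fun i => ω.getVert i) =
      ∑ e : StepSeq d k, Φ (Torus.proj n (endpoint e)) *
        ENNReal.ofReal (fkWeight n v k fun i => pos e i) := by
  classical
  have h1 : ∑ x ∈ box d k, ∑ ω ∈ (zdGraph d).finsetWalkLength k (0 : Site d) x,
      Φ (Torus.proj n x) * ENNReal.ofReal (fkWeight n v ω.length fun i => ω.getVert i) =
      ∑ x ∈ box d k, ∑ ω ∈ (zdGraph d).finsetWalkLength k (0 : Site d) x,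
        Φ (Torus.proj n x) * ENNReal.ofReal (fkWeight n v k fun i => ω.getVert i) := by
    refine Finset.sum_congr rfl fun x _ => Finset.sum_congr rfl fun ω hω => ?_
    rw [(SimpleGraph.mem_finsetWalkLength_iff.1 hω)]
  rw [h1, sum_walks_eq_sum_stepSeq (fun x (ω : (zdGraph d).Walk (0 : Site d) x) =>
    Φ (Torus.proj n x) * ENNReal.ofReal (fkWeight n v k fun i => ω.getVert i))]
  refine Finset.sum_congr rfl fun e _ => ?_
  congr 2
  exact fkWeight_congr v fun i hi => getVert_toWalk e hi

/-! ### The recursion on the torus: first-step analysis -/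

/-- The `k`-jump layer started from `y ∈ Λ` with a real weight `φ` at the endpoint:
`S_k(y) = Σ_{e : k steps} φ(y + ē(k)) Π_{i≤k}(2d + v(y + ē(i)))⁻¹`. [folklore] -/
def stepSeqSum (n : ℕ) (v φ : TorusSite d n → ℝ) (k : ℕ) (y : TorusSite d n) : ℝ :=
  ∑ e : StepSeq d k, φ (y + Torus.proj n (endpoint e)) *
    ∏ i ∈ Finset.range (k + 1), (2 * d + v (y + Torus.proj n (pos e i)))⁻¹

/-- No jumps: `S_0(y) = φ(y)/(2d + v(y))`. [folklore] -/
theorem stepSeqSum_zero (v φ : TorusSite d n → ℝ) (y : TorusSite d n) :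
    stepSeqSum n v φ 0 y = (2 * d + v y)⁻¹ * φ y := by
  simp [stepSeqSum, mul_comm]

/-- **First-step analysis**: `S_{k+1}(y) = (2d + v(y))⁻¹ Σ_{|a|=1} S_k(y + ā)`. [folklore] -/
theorem stepSeqSum_succ (v φ : TorusSite d n → ℝ) (k : ℕ) (y : TorusSite d n) :
    stepSeqSum n v φ (k + 1) y = (2 * d + v y)⁻¹ * ∑ a : Dir d, stepSeqSum n v φ k (y + torusStep n a) := by
  unfold stepSeqSum
  rw [Finset.mul_sum]
  rw [← Fintype.sum_equiv (Fin.consEquiv fun _ : Fin (k + 1) => Dir d)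
    (fun p : Dir d × (Fin k → Dir d) => φ (y + Torus.proj n (endpoint (Fin.cons p.1 p.2 : StepSeq d (k + 1)))) *
      ∏ i ∈ Finset.range (k + 1 + 1), (2 * d + v (y + Torus.proj n (pos (Fin.cons p.1 p.2 : StepSeq d (k + 1)) i)))⁻¹)
    _ (fun p => rfl)]
  rw [Fintype.sum_prod_type]
  refine Finset.sum_congr rfl fun a _ => ?_
  rw [Finset.mul_sum]
  refine Finset.sum_congr rfl fun e _ => ?_
  rw [Finset.prod_range_succ' _ (k + 1)]
  simp only [torusProj_pos_cons_zero, add_zero, torusProj_endpoint_cons, torusProj_pos_cons_succ]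
  simp only [← add_assoc]
  ring

/-- `(Tf)(y) = (2d + v(y))⁻¹ Σ_{|a|=1} f(y + ā)`. [folklore] -/
theorem transferMatrix_mulVec [NeZero n] (v f : TorusSite d n → ℝ) (y : TorusSite d n) :
    (transferMatrix d n v).mulVec f y = (2 * d + v y)⁻¹ * ∑ a : Dir d, f (y + torusStep n a) := by
  rw [← torusStepMatrix_mulVec f y]
  simp only [Matrix.mulVec, dotProduct, transferMatrix_apply, Finset.mul_sum, mul_assoc]

/-- **`S_k = T^k D⁻¹ φ`**: the `k`-jump layer is the `k`-th term of the resolvent series applied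
to `φ`. [folklore] -/
theorem stepSeqSum_eq_mulVec [NeZero n] (v φ : TorusSite d n → ℝ) :
    ∀ k : ℕ, stepSeqSum n v φ k = (resolventTerm v k).mulVec φ
  | 0 => by
    funext y
    rw [stepSeqSum_zero, resolventTerm, pow_zero, one_mul, Matrix.mulVec_diagonal]
  | k + 1 => by
    funext y
    rw [stepSeqSum_succ, resolventTerm, pow_succ', mul_assoc, ← Matrix.mulVec_mulVec,
      transferMatrix_mulVec]
    congr 1
    refine Finset.sum_congr rfl fun a _ => ?_
    rw [stepSeqSum_eq_mulVec v φ k]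
    rfl

/-- The `k`-jump layer with the indicator weight at `b`, started from `0`, is the entry
`(T^k D⁻¹)_{0,b}`. [folklore] -/
theorem stepSeqSum_indicator [NeZero n] (v : TorusSite d n → ℝ) (k : ℕ) (b : TorusSite d n) :
    stepSeqSum n v (fun y => if y = b then 1 else 0) k 0 = resolventTerm v k 0 b := by
  classical
  rw [stepSeqSum_eq_mulVec]
  have h : (fun y : TorusSite d n => if y = b then (1 : ℝ) else 0) = Pi.single b 1 := by
    funext y; by_cases hy : y = b
    · subst hy; simp
    · simp [hy]
  rw [h, Matrix.mulVec_single_one]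
  rfl

/-! ### The resolvent identity -/

/-- The `k`-jump layer of the time-integrated Feynman–Kac functional, grouped by the endpoint class:
`Σ_e Φ(ē(k)) w(e) = Σ_b Φ(b) (T^k D⁻¹)_{0,b}`. [folklore] -/
theorem sum_stepSeq_fkWeight_eq [NeZero n] (hv : ∀ y, 0 < 2 * d + v y) (Φ : TorusSite d n → ℝ≥0∞)
    (k : ℕ) :
    ∑ e : StepSeq d k, Φ (Torus.proj n (endpoint e)) * ENNReal.ofReal (fkWeight n v k fun i => pos e i) =
      ∑ b : TorusSite d n, Φ b * ENNReal.ofReal (resolventTerm v k 0 b) := by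
  classical
  -- group the step sequences by the class `b` of their endpoint
  rw [← Finset.sum_fiberwise Finset.univ (fun e : StepSeq d k => Torus.proj n (endpoint e))]
  refine Finset.sum_congr rfl fun b _ => ?_
  rw [Finset.sum_filter]
  have h1 : ∀ e : StepSeq d k,
      (if Torus.proj n (endpoint e) = b then
        Φ (Torus.proj n (endpoint e)) * ENNReal.ofReal (fkWeight n v k fun i => pos e i) else 0) =
      Φ b * ENNReal.ofReal ((if (0 : TorusSite d n) + Torus.proj n (endpoint e) = b then 1 else 0) *
        ∏ i ∈ Finset.range (k + 1), (2 * d + v ((0 : TorusSite d n) + Torus.proj n (pos e i)))⁻¹) := by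
    intro e
    simp only [zero_add]
    by_cases he : Torus.proj n (endpoint e) = b
    · rw [if_pos he, if_pos he, he, one_mul]; rfl
    · rw [if_neg he, if_neg he, zero_mul, ENNReal.ofReal_zero, mul_zero]
  simp_rw [h1]
  rw [← Finset.mul_sum, ← ENNReal.ofReal_sum_of_nonneg]
  · rw [← stepSeqSum_indicator v k b, stepSeqSum]
  · intro e _
    refine mul_nonneg (by split_ifs <;> norm_num) (Finset.prod_nonneg fun i _ => (inv_pos.2 (hv _)).le)

/-- **The resolvent identity (Feynman–Kac, time-integrated)**: for a potential `v ≥ m > 0` on the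
torus `Λ = ℤ^d/nℤ^d` (`n ≥ 1`) and any weight `Φ ≥ 0`,
`∫₀^∞ E^Λ_0[e^{-∫₀ᵀ v(X_s)ds} Φ(X_T)] dT = Σ_{b∈Λ} (-Δ_Λ + v)⁻¹_{0,b} Φ(b)`. With `Φ = 𝟙_b` and
`v ≡ m²` this is the statement that the two-point function of the free (`g = 0`) continuous-time
walk killed at rate `m²` is the lattice Green function `C = (-Δ_Λ + m²)⁻¹` ("if we set `V₀ = 0`
… the result is … the simple random walk two-point function with mass `m²`", §4.1).
[cite: BauerschmidtBrydgesSlade2015LogCorr, §4.1 (C = (-Δ+m²)⁻¹; V₀ = 0 gives the simple random walk two-point function)] -/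
theorem lintegral_Ioi_torusFKExpectation [NeZero n] {m : ℝ} (hm : 0 < m) (hv : ∀ y, m ≤ v y)
    (Φ : TorusSite d n → ℝ≥0∞) :
    ∫⁻ T in Ioi 0, torusFKExpectation d n v T Φ =
      ∑ b : TorusSite d n, ENNReal.ofReal ((schrodingerMatrix d n v)⁻¹ 0 b) * Φ b := by
  classical
  have hm' : 0 < 2 * d + m := by positivity
  have hv' : ∀ y, 0 < 2 * d + v y := fun y => lt_of_lt_of_le hm' (by linarith [hv y])
  -- Step 1: exchange the time integral with the sums, integrate each skeleton
  have hmeas : ∀ k : ℕ, Measurable fun T : ℝ => ∑ x ∈ box d k,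
      ∑ ω ∈ (zdGraph d).finsetWalkLength k (0 : Site d) x,
        Φ (Torus.proj n x) * (ENNReal.ofReal (Real.exp (-(2 * d) * T)) * fkPathIntegral n v T ω) :=
    fun k => Finset.measurable_sum _ fun x _ => Finset.measurable_sum _ fun ω _ =>
      (measurable_fkPathIntegral_weighted v ω).const_mul _
  have h1 : ∫⁻ T in Ioi 0, torusFKExpectation d n v T Φ =
      ∑' k : ℕ, ∑ x ∈ box d k, ∑ ω ∈ (zdGraph d).finsetWalkLength k (0 : Site d) x,
        Φ (Torus.proj n x) * ENNReal.ofReal (fkWeight n v ω.length fun i => ω.getVert i) := by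
    unfold torusFKExpectation
    simp_rw [← ENNReal.tsum_mul_left, Finset.mul_sum, mul_left_comm (ENNReal.ofReal _)]
    rw [lintegral_tsum fun k => (hmeas k).aemeasurable]
    refine tsum_congr fun k => ?_
    rw [lintegral_finsetSum _ fun x _ => Finset.measurable_sum _ fun ω _ =>
      (measurable_fkPathIntegral_weighted v ω).const_mul _]
    refine Finset.sum_congr rfl fun x _ => ?_
    rw [lintegral_finsetSum _ fun ω _ => (measurable_fkPathIntegral_weighted v ω).const_mul _]
    refine Finset.sum_congr rfl fun ω _ => ?_
    rw [lintegral_const_mul _ (measurable_fkPathIntegral_weighted v ω),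
      lintegral_Ioi_fkPathIntegral hv' ω]
  rw [h1]
  -- Step 2: step sequences, grouped by endpoint class: the `k`-th resolvent term
  simp_rw [sum_walks_fkWeight, sum_stepSeq_fkWeight_eq hv']
  -- Step 3: sum the resolvent series
  rw [Summable.tsum_finsetSum (fun _ _ => ENNReal.summable)]
  refine Finset.sum_congr rfl fun b _ => ?_
  rw [ENNReal.tsum_mul_left, mul_comm, schrodingerMatrix_inv hm hv, resolventMatrix_apply,
    ENNReal.ofReal_tsum_of_nonneg (fun k => resolventTerm_nonneg hv' k 0 b)
      (summable_resolventTerm hm hv 0 b)]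

/-- **The free two-point function is the Green function**: with `Φ = 𝟙_b`,
`∫₀^∞ E^Λ_0[e^{-∫₀ᵀ v(X_s)ds} 𝟙_{X_T = b}] dT = (-Δ_Λ + v)⁻¹_{0,b}` (`v ≥ m > 0`).
[cite: BauerschmidtBrydgesSlade2015LogCorr, §4.1 (C = (-Δ+m²)⁻¹ is the simple random walk two-point function with mass m²)] -/
theorem lintegral_Ioi_torusFKExpectation_indicator [NeZero n] {m : ℝ} (hm : 0 < m)
    (hv : ∀ y, m ≤ v y) (b : TorusSite d n) :
    ∫⁻ T in Ioi 0, torusFKExpectation d n v T (fun y => if y = b then 1 else 0) =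
      ENNReal.ofReal ((schrodingerMatrix d n v)⁻¹ 0 b) := by
  classical
  rw [lintegral_Ioi_torusFKExpectation hm hv]
  simp only [mul_ite, mul_one, mul_zero]
  rw [Finset.sum_ite_eq' Finset.univ b]
  simp

/-- **Total mass**: `∫₀^∞ E^Λ_0[e^{-m²T}] dT = Σ_b (-Δ_Λ + m²)⁻¹_{0,b} = 1/m²` — the free
susceptibility on the torus is exactly `1/m²` (`m² > 0`, `n ≥ 1`), i.e. `χ̂_N = 1/m²` at `V₀ = 0`.
[cite: BauerschmidtBrydgesSlade2015LogCorr, §4.1 (C1 = m⁻²1)] -/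
theorem lintegral_Ioi_torusFKExpectation_const_one [NeZero n] {m2 : ℝ} (hm2 : 0 < m2) :
    ∫⁻ T in Ioi 0, torusFKExpectation d n (fun _ => m2) T (fun _ => 1) = ENNReal.ofReal m2⁻¹ := by
  rw [lintegral_Ioi_torusFKExpectation hm2 (fun _ => le_rfl)]
  simp only [mul_one]
  rw [← ENNReal.ofReal_sum_of_nonneg fun b _ => schrodingerMatrix_inv_nonneg hm2 (fun _ => le_rfl) 0 b,
    sum_schrodingerMatrix_const_inv hm2]

end FeynmanKac

end CTWSAW

end Literature.Barriers.CriticalPhenomena
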